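import Summits.PneNP.PneNP.Theses.DirichletPigeons
import Literature.NumberTheory.DiophantineApproximation.SimultaneousApproxComplexityProofs

/-!
# Route DirichletPigeons — `GsaMemNP` (stmt-PneNP-10863)

GSA ∈ NP: the route's inline language `encG '' {I | yes I}` is, definitionally, Lagarias' GOOD SIMULTANEOUS
APPROXIMATION language `Literature.NumberTheory.DiophantineApproximation.gsaLang`
(`SimultaneousApproxInstance.encoding.toLanguage {I | I.Yes}`; the encoding is the literal composite the route
inlines and `distNearestInt x = |x - round x|`), whose membership in `NP` is the proved tree theorem
`Lagarias.gsaLang_mem_NP` (certificate = the denominator `q ≤ N` in binary).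
-/

set_option linter.dupNamespace false -- `Summit.PneNP.PneNP.…`: summit = sub-problem name (D-0017 single-conjunct layout)

namespace Summit.PneNP.PneNP.Theorems

open Literature.NumberTheory.DiophantineApproximation

/-- **Support item `GsaMemNP` of route DirichletPigeons (stmt-PneNP-10863)**: Lagarias' GOOD SIMULTANEOUS
APPROXIMATION language is in `NP` — the route's inline language is definitionally `gsaLang`, and
`Lagarias.gsaLang_mem_NP` is proved in the tree. [cite: Lagarias1985, main theorem (membership half)] -/
theorem dirichletPigeons_gsaMemNP_proof : Summit.PneNP.PneNP.Theses.DirichletPigeons.GsaMemNP := by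
  unfold Summit.PneNP.PneNP.Theses.DirichletPigeons.GsaMemNP
  exact Lagarias.gsaLang_mem_NP

end Summit.PneNP.PneNP.Theorems
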